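import Summits.QuantumFields.BalabanUV.T4Continuum.Support.ApproxRefineEnd
import Summits.QuantumFields.BalabanUV.T4Continuum.Support.MinimalActionFinalApprox
import Summits.QuantumFields.BalabanUV.T4Continuum.Support.MinimalActionMismatchSmall
import Summits.QuantumFields.BalabanUV.T4Continuum.Support.MinimalActionClassAgnostic
import HarnessLib

/-!
# T⁴ programme, node NE3 (η-rate of the minimisers) — THE ACTION SANDWICH, final assembly, part 4b:
# ROUTE (A) ON B11 THEOREM 1 TYPE ALONE — (H∃) + `b, c ≤ t` + explicit thresholds ⇒ `ActionRate … (L⁻²)` with a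
# constant depending on `d` and `L` only

NE3 prover lineage P1, gen 18 (cell `pub-balaban`, unit `b2b-balaban-t4-ne3-p1`, `HOME/BINDER-OWNERS.md` row NE3 OWNER;
skeleton `t4/b2b-balaban-t4-ne3-p1/SKELETON-NE3-P1.md` v1.5; g17 HANDOFF «file the FINAL corollary `actionRate_sfClass_thm1Type`»).

COMPOSITION BY NAME (no new mathematics): the crew's leaf R1 END `ApproxRefineEnd.approxRefine_sfClass` (leaf-09 g2, part 3c:
`ApproxRefine d (sfClass d L N ε) L N b c b₁ c₁ m` with CLOSED `b₁ c₁ m` in `(d, L, b, c)`, from five numeric inequalities) +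
its threshold `ApproxRefineRegime.sideConds_of_small` + the linear envelopes `fillRadius_le_of_small`, `gradRadius_le_of_small`
(crew) and `MinimalActionMismatchSmall.mismatch_le_of_small` (owner, p213957) + the owner socket
`MinimalActionClassAgnostic.actionRate_of_exists_approx_class_linear` (part 5) ⇒ **`actionRate_thm1Type_class`** (ANY class family
`𝒞 ⊇ sfClass d L N ε` levelwise — e.g. B11's (6) read exactly, D-s3-1) and its case **`actionRate_sfClass_thm1Type`**:
for `d ≥ 1`, `L, N ≥ 1`, `0 ≤ b ≤ t`, `0 ≤ c ≤ t`, FIVE explicit thresholds `Tᵢ(d,L)·t ≤ 1` — (i) the crew's `K` of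
`sideConds_of_small`, (ii) `2¹⁵(d+1)²(d+4)²L²`, (iii) `2¹⁴(d+1)(d+4)L^{2d+3}(K_b + K_m)`, (iv) `K_b + 8K_mL^{d+2}`,
(v) `K_c + 36K_mL^{d+2}` (sum them for ONE threshold; `K_b, K_c` = the crew's envelopes of the refinement's radii, `K_m` = the
owner's envelope of the mismatch constant, all displayed polynomials in `d, L, gradRem d`) — and a class radius
`ε ≥ 18(K_b + K_m)L^{d+2}·t`: (H∃) ⇒ `ActionRate (minActReadings d (sfClass d L N ε) L N dom loc)
(wallConstNA(d,L)·(gradConst d 1 + 1)/L²) (L⁻²)` — a constant depending on `d, L` ONLY (the limit form with geometric tail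
follows by `T4EtaRateMin.ActionRate.exists_limit`, cf. `MinimalActionFinalApprox.exists_tendsto_minAct_of_exists_approx`).

HONEST FRAMING.  **NE3 is NOT proved**: (H∃) is [Balaban1985Variational] Thm 1 p. 279 TYPE in the GLOBAL reading over the
chosen class family `𝒞 ⊇ sfClass ε` (for `𝒞 = sfClass`: closed plaquette condition, NO current condition (1.9) — DIVERGENCE
D-s3-1∕D-s3-2; journal l.9473 «why the rate needs the margin»), a hypothesis asserted for nothing here; the LOCAL half of `T4EtaRateMin.NE3Shape`
(readings (D)∕(F)) is untouched; spine PROVED count 0∕9 unchanged.  No conditional of the cell (`BetaPertH`, (B), (B^μ),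
G-an2-4) occurs; nothing printed is a hypothesis; no `def`, no `sorry`, axioms ⊆ {propext, Classical.choice, Quot.sound}.
Finite T⁴ rung (B)+1 — NOT infinite volume, NOT a mass gap, NOT the Clay problem, NOT summit progress.  PLACEMENT (human
rule 2026-08-19): `Summits/QuantumFields/BalabanUV/`.  HONEST DEPENDENCY (cell page 1): continuum YM on T⁴ ⇐ BetaPertH ∧
nine spine estimates (0/9 proved); BetaPertH ⇐ (D1) ∧ (D4) ∧ CAP+tail; G-an2-4 gates asym, D1 and NE2/3/4.
-/

set_option autoImplicit false

open scoped BigOperators Matrix Matrix.Norms.L2Operator Topology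
open NormedSpace Filter

namespace Summit.QuantumFields.BalabanUV.T4Continuum.MinimalActionThm1Type

open Literature.MathematicalPhysics.QuantumFieldTheory.Balaban1983to89
open B7Prop1Explicit B7Prop2Explicit
open T4AveragingDeficitWall hiding Site Plane Plaq Bond
open T4AveragingDeficitNonAbelian (wallConstNA wallConstNA_nonneg)
open T4EtaRateMin (Readings ActionRate)
open MinimalActionSandwich MinimalActionRate MinimalActionRefine SmoothRefineOfApprox ChainEndFix
open MinimalActionFinalApprox MinimalActionMismatchSmall MinimalActionClassAgnostic
open MinimalActionWitness (flatCfg isMinimiser_sfClass_flatCfg)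
open SkeletonPrecompGrad (gradRem gradRem_nonneg)
open ApproxRefineRegime (sideConds_of_small fillRadius_le_of_small gradRadius_le_of_small)
open ApproxRefineEnd (approxRefine_sfClass)

noncomputable section

variable {d : ℕ} {n : Type*} [Fintype n] [DecidableEq n] [Nonempty n]

/-! ## §1 `ActionRate` is monotone in its constant -/

omit [Fintype n] [DecidableEq n] [Nonempty n] in
/-- `ActionRate` is monotone in the constant (for a nonnegative rate). [folklore] -/
theorem actionRate_mono {ι X : Type*} {R : Readings ι X} {C C' θ : ℝ} (h : ActionRate R C θ) (hCC' : C ≤ C')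
    (hθ : 0 ≤ θ) : ActionRate R C' θ := by
  intro k V hV
  refine (h k V hV).trans ?_
  have h1 : 0 ≤ θ ^ k * R.vol := mul_nonneg (pow_nonneg hθ k) R.vol_nonneg
  nlinarith

omit [Fintype n] [DecidableEq n] [Nonempty n] in
/-- Pure-real core of the constant normalisation: with `B ≤ K_B·t`, `C ≤ K_C·t`, `M ≤ K_M·t` and the thresholds
`(K_B + 8K_M·P)·t ≤ 1`, `(K_C + 36K_M·P)·t ≤ 1` (`P = L^{d+2} ≥ 0`), both `B + 8MP ≤ 1` and `C + 36MP ≤ 1`. [folklore] -/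
theorem radii_le_one {t B C M KB KC KM P : ℝ} (hP : 0 ≤ P) (hB1 : B ≤ KB * t) (hC1 : C ≤ KC * t)
    (hM1 : M ≤ KM * t) (hT4 : (KB + 8 * KM * P) * t ≤ 1) (hT5 : (KC + 36 * KM * P) * t ≤ 1) :
    B + 8 * M * P ≤ 1 ∧ C + 36 * M * P ≤ 1 := by
  have hMP : M * P ≤ KM * t * P := mul_le_mul_of_nonneg_right hM1 hP
  constructor <;> nlinarith

/-! ## §2 Route (A) on B11 Theorem 1 TYPE alone -/

/-- **NE3, ROUTE (A) — THE η-RATE OF THE MINIMAL ACTIONS FROM B11 THEOREM 1 TYPE ALONE, OVER ANY CLASS FAMILY CONTAINING A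
SMALL-FIELD BALL** (`sfClass d L N ε j ⊆ 𝒞 j` for all `j`; e.g. B11's class (6) read exactly as printed, D-s3-1).  Let `d ≥ 1`, `L, N ≥ 1`,
`0 ≤ b ≤ t`, `0 ≤ c ≤ t`, with `t` below the five displayed thresholds ((i) the crew's `K` of
`ApproxRefineRegime.sideConds_of_small`; (ii) `2¹⁵(d+1)²(d+4)²L²`; (iii) `2¹⁴(d+1)(d+4)L^{2d+3}·(K_b + K_m)`;
(iv) `K_b + 8K_m·L^{d+2}`; (v) `K_c + 36K_m·L^{d+2}` — each `·t ≤ 1`), and let the class radius satisfy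
`18(K_b + K_m)L^{d+2}·t ≤ ε`.  IF (H∃) every datum `V ∈ dom` has, at every level `k`, SOME minimiser of the level-`k` Wilson
action over the class `𝒞 k` under the `k`-fold block-average constraint with sup-form regularity `(b, c)`
([Balaban1985Variational] Thm 1 (8)+(9)+(10) p. 279 TYPE, GLOBAL reading — a hypothesis), THEN
`ActionRate (minActReadings d 𝒞 L N dom loc) (wallConstNA(d,L)·(gradConst d 1 + 1)/L²) (L⁻²)`:
`|A_{k+1}(V) − A_k(V)| ≤ [wallConstNA(d,L)(gradConst d 1 + 1)/L²]·(L⁻²)^k·N^d` for all `k` and all `V ∈ dom`.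
NE3 is NOT proved by this. [folklore] -/
theorem actionRate_thm1Type_class (hd : 1 ≤ d) {𝒞 : ℕ → Set (Site d → Fin d → (Matrix n n ℂ)ˣ)} {L N : ℕ}
    (hL : 1 ≤ L) (hN : 1 ≤ N) {b c t ε : ℝ} (hb : 0 ≤ b) (hc : 0 ≤ c) (hbt : b ≤ t) (hct : c ≤ t)
    (hsub : ∀ j, sfClass d L N ε j ⊆ 𝒞 j)
    (hT1 : (160 * d + 168 * (d : ℝ) ^ 2 + 2 * (32 * d + (24 * d * (2 * (d : ℝ) + gradRem d) + 14336 * (d : ℝ) ^ 2 * ((d : ℝ) + 1) ^ 2)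
            + 12 * (2 * (d : ℝ) + gradRem d))
        + 512 * ((d : ℝ) + 1) * ((d : ℝ) + 4) * (L : ℝ) ^ 2
          * (32 * d + 48 * d * (L : ℝ) ^ 2 * (2 * (d : ℝ) + gradRem d)
            + 8192 * (d : ℝ) ^ 2 * (2 * (d : ℝ) + 1) ^ 2 * (L : ℝ) ^ 2)) * t ≤ 1)
    (hT2 : 2 ^ 15 * ((d : ℝ) + 1) ^ 2 * ((d : ℝ) + 4) ^ 2 * (L : ℝ) ^ 2 * t ≤ 1)
    (hT3 : 2 ^ 14 * ((d : ℝ) + 1) * ((d : ℝ) + 4) * (L : ℝ) ^ (2 * d + 3)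
          * ((32 * d + 48 * d * (L : ℝ) ^ 2 * (2 * (d : ℝ) + gradRem d)
              + 8192 * (d : ℝ) ^ 2 * (2 * (d : ℝ) + 1) ^ 2 * (L : ℝ) ^ 2)
            + (3 * (1280 * d * ((d : ℝ) + 1) ^ 2 * ((d : ℝ) + 4) ^ 2 * (L : ℝ) ^ 2
            * (32 * d + 48 * d * (L : ℝ) ^ 2 * (2 * (d : ℝ) + gradRem d)
              + 8192 * (d : ℝ) ^ 2 * (2 * (d : ℝ) + 1) ^ 2 * (L : ℝ) ^ 2) ^ 2
          + d * ((d : ℝ) + 1) * ((L : ℝ) ^ 3 * (256 * (d : ℝ) ^ 2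
              * (32 * d + (24 * d * (2 * (d : ℝ) + gradRem d) + 14336 * (d : ℝ) ^ 2 * ((d : ℝ) + 1) ^ 2)
                + 12 * (2 * (d : ℝ) + gradRem d))
            + 4 * (24 * d * (2 * (d : ℝ) + gradRem d) + 14336 * (d : ℝ) ^ 2 * ((d : ℝ) + 1) ^ 2)
            + 24 * (2 * (d : ℝ) + gradRem d)))
          + ((d : ℝ) - 1) ^ 2 * (37 * ((d : ℝ) - 1) + 5)))) * t ≤ 1)
    (hT4 : ((32 * d + 48 * d * (L : ℝ) ^ 2 * (2 * (d : ℝ) + gradRem d)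
              + 8192 * (d : ℝ) ^ 2 * (2 * (d : ℝ) + 1) ^ 2 * (L : ℝ) ^ 2)
            + 8 * (3 * (1280 * d * ((d : ℝ) + 1) ^ 2 * ((d : ℝ) + 4) ^ 2 * (L : ℝ) ^ 2
            * (32 * d + 48 * d * (L : ℝ) ^ 2 * (2 * (d : ℝ) + gradRem d)
              + 8192 * (d : ℝ) ^ 2 * (2 * (d : ℝ) + 1) ^ 2 * (L : ℝ) ^ 2) ^ 2
          + d * ((d : ℝ) + 1) * ((L : ℝ) ^ 3 * (256 * (d : ℝ) ^ 2
              * (32 * d + (24 * d * (2 * (d : ℝ) + gradRem d) + 14336 * (d : ℝ) ^ 2 * ((d : ℝ) + 1) ^ 2)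
                + 12 * (2 * (d : ℝ) + gradRem d))
            + 4 * (24 * d * (2 * (d : ℝ) + gradRem d) + 14336 * (d : ℝ) ^ 2 * ((d : ℝ) + 1) ^ 2)
            + 24 * (2 * (d : ℝ) + gradRem d)))
          + ((d : ℝ) - 1) ^ 2 * (37 * ((d : ℝ) - 1) + 5))) * (L : ℝ) ^ (d + 2)) * t ≤ 1)
    (hT5 : (((L : ℝ) ^ 3 * (256 * (d : ℝ) ^ 2
              * (32 * d + (24 * d * (2 * (d : ℝ) + gradRem d) + 14336 * (d : ℝ) ^ 2 * ((d : ℝ) + 1) ^ 2)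
                + 12 * (2 * (d : ℝ) + gradRem d))
            + 4 * (24 * d * (2 * (d : ℝ) + gradRem d) + 14336 * (d : ℝ) ^ 2 * ((d : ℝ) + 1) ^ 2)
            + 24 * (2 * (d : ℝ) + gradRem d)))
            + 36 * (3 * (1280 * d * ((d : ℝ) + 1) ^ 2 * ((d : ℝ) + 4) ^ 2 * (L : ℝ) ^ 2
            * (32 * d + 48 * d * (L : ℝ) ^ 2 * (2 * (d : ℝ) + gradRem d)
              + 8192 * (d : ℝ) ^ 2 * (2 * (d : ℝ) + 1) ^ 2 * (L : ℝ) ^ 2) ^ 2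
          + d * ((d : ℝ) + 1) * ((L : ℝ) ^ 3 * (256 * (d : ℝ) ^ 2
              * (32 * d + (24 * d * (2 * (d : ℝ) + gradRem d) + 14336 * (d : ℝ) ^ 2 * ((d : ℝ) + 1) ^ 2)
                + 12 * (2 * (d : ℝ) + gradRem d))
            + 4 * (24 * d * (2 * (d : ℝ) + gradRem d) + 14336 * (d : ℝ) ^ 2 * ((d : ℝ) + 1) ^ 2)
            + 24 * (2 * (d : ℝ) + gradRem d)))
          + ((d : ℝ) - 1) ^ 2 * (37 * ((d : ℝ) - 1) + 5))) * (L : ℝ) ^ (d + 2)) * t ≤ 1)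
    (hεt : 18 * ((32 * d + 48 * d * (L : ℝ) ^ 2 * (2 * (d : ℝ) + gradRem d)
              + 8192 * (d : ℝ) ^ 2 * (2 * (d : ℝ) + 1) ^ 2 * (L : ℝ) ^ 2)
            + (3 * (1280 * d * ((d : ℝ) + 1) ^ 2 * ((d : ℝ) + 4) ^ 2 * (L : ℝ) ^ 2
            * (32 * d + 48 * d * (L : ℝ) ^ 2 * (2 * (d : ℝ) + gradRem d)
              + 8192 * (d : ℝ) ^ 2 * (2 * (d : ℝ) + 1) ^ 2 * (L : ℝ) ^ 2) ^ 2
          + d * ((d : ℝ) + 1) * ((L : ℝ) ^ 3 * (256 * (d : ℝ) ^ 2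
              * (32 * d + (24 * d * (2 * (d : ℝ) + gradRem d) + 14336 * (d : ℝ) ^ 2 * ((d : ℝ) + 1) ^ 2)
                + 12 * (2 * (d : ℝ) + gradRem d))
            + 4 * (24 * d * (2 * (d : ℝ) + gradRem d) + 14336 * (d : ℝ) ^ 2 * ((d : ℝ) + 1) ^ 2)
            + 24 * (2 * (d : ℝ) + gradRem d)))
          + ((d : ℝ) - 1) ^ 2 * (37 * ((d : ℝ) - 1) + 5)))) * (L : ℝ) ^ (d + 2) * t ≤ ε)
    {dom : Set (Site d → Fin d → (Matrix n n ℂ)ˣ)}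
    (hmin : ∀ V ∈ dom, ∀ k : ℕ, ∃ U, IsMinimiser d 𝒞 L N k V U ∧ RegularSup d L N b c k U)
    {X : Type*} (loc : ℕ → (Site d → Fin d → (Matrix n n ℂ)ˣ) → X → ℝ) :
    ActionRate (minActReadings d 𝒞 L N dom loc)
      (wallConstNA d L * (gradConst d 1 + 1) / (L : ℝ) ^ 2) (((L : ℝ) ^ 2)⁻¹) := by
  have hL1 : (1 : ℝ) ≤ L := by exact_mod_cast hL
  have hL0 : (0 : ℝ) < L := by linarith
  have hd1 : (1 : ℝ) ≤ d := by exact_mod_cast hd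
  have hd0 : (0 : ℝ) ≤ d := by positivity
  have ht0 : 0 ≤ t := hb.trans hbt
  have hΓ := gradRem_nonneg hd
  have hLd2 : 0 ≤ (L : ℝ) ^ (d + 2) := by positivity
  -- `t ≤ 1` from (ii)
  have ht1 : t ≤ 1 := by
    have h1' : (1 : ℝ) ≤ ((d : ℝ) + 1) ^ 2 := one_le_pow₀ (by linarith)
    have h4' : (1 : ℝ) ≤ ((d : ℝ) + 4) ^ 2 := one_le_pow₀ (by linarith)
    have hL2 : (1 : ℝ) ≤ (L : ℝ) ^ 2 := one_le_pow₀ hL1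
    have hc2 : (1 : ℝ) ≤ 2 ^ 15 * ((d : ℝ) + 1) ^ 2 * ((d : ℝ) + 4) ^ 2 * (L : ℝ) ^ 2 :=
      one_le_mul_of_one_le_of_one_le (one_le_mul_of_one_le_of_one_le
        (one_le_mul_of_one_le_of_one_le (by norm_num) h1') h4') hL2
    have := mul_le_mul_of_nonneg_right hc2 ht0
    linarith
  -- the crew's R1 END and the envelopes (all stated with the displayed closed expressions)
  obtain ⟨h16, hdb, hquarter, hhalf, h512⟩ := sideConds_of_small hd hL hb hc hbt hct hT1
  have hA := approxRefine_sfClass (n := n) hd L N hL (ε := ε) hb hc h16 hdb hquarter hhalf h512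
  have hB1 := fillRadius_le_of_small hd L hb hbt hct ht1
  have hB0 := fillRadius_nonneg hd L hb hc
  have hC1 := gradRadius_le_of_small hd L hb hc hbt hct ht1
  have hM1 := mismatch_le_of_small hd L hb hc hbt hct ht1
  have hM0 := mismatch_nonneg hd L hb hc
  have hKB0 : 0 ≤ (32 * d + 48 * d * (L : ℝ) ^ 2 * (2 * (d : ℝ) + gradRem d)
              + 8192 * (d : ℝ) ^ 2 * (2 * (d : ℝ) + 1) ^ 2 * (L : ℝ) ^ 2) := by positivity
  have hKB1 : 1 ≤ (32 * d + 48 * d * (L : ℝ) ^ 2 * (2 * (d : ℝ) + gradRem d)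
              + 8192 * (d : ℝ) ^ 2 * (2 * (d : ℝ) + 1) ^ 2 * (L : ℝ) ^ 2) := by
    have h48 : 0 ≤ 48 * d * (L : ℝ) ^ 2 * (2 * (d : ℝ) + gradRem d) := by positivity
    have h8192 : 0 ≤ 8192 * (d : ℝ) ^ 2 * (2 * (d : ℝ) + 1) ^ 2 * (L : ℝ) ^ 2 := by positivity
    linarith
  have hKM0 : 0 ≤ (3 * (1280 * d * ((d : ℝ) + 1) ^ 2 * ((d : ℝ) + 4) ^ 2 * (L : ℝ) ^ 2
            * (32 * d + 48 * d * (L : ℝ) ^ 2 * (2 * (d : ℝ) + gradRem d)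
              + 8192 * (d : ℝ) ^ 2 * (2 * (d : ℝ) + 1) ^ 2 * (L : ℝ) ^ 2) ^ 2
          + d * ((d : ℝ) + 1) * ((L : ℝ) ^ 3 * (256 * (d : ℝ) ^ 2
              * (32 * d + (24 * d * (2 * (d : ℝ) + gradRem d) + 14336 * (d : ℝ) ^ 2 * ((d : ℝ) + 1) ^ 2)
                + 12 * (2 * (d : ℝ) + gradRem d))
            + 4 * (24 * d * (2 * (d : ℝ) + gradRem d) + 14336 * (d : ℝ) ^ 2 * ((d : ℝ) + 1) ^ 2)
            + 24 * (2 * (d : ℝ) + gradRem d)))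
          + ((d : ℝ) - 1) ^ 2 * (37 * ((d : ℝ) - 1) + 5))) := by
    have h37 : 0 ≤ 37 * ((d : ℝ) - 1) + 5 := by linarith
    positivity
  -- linear bounds with the common constant `K_b + K_m ≥ 1` (structural steps only — the expressions are large)
  have hKsum := le_add_of_le_of_nonneg hKB1 hKM0
  have hB1' := hB1.trans (mul_le_mul_of_nonneg_right (le_add_of_nonneg_right hKM0) ht0)
  have hM1' := hM1.trans (mul_le_mul_of_nonneg_right (le_add_of_nonneg_left hKB0) ht0)
  have hrate := actionRate_of_exists_approx_class_linear hd hL hN ht0 hKsum hb hB0 hM0 hbt hB1' hM1' hsub hT2 hT3 hεt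
    hmin hA loc
  -- normalise the constant: both `max`es are `≤ 1`
  refine actionRate_mono hrate ?_ (by positivity)
  have hg : (L : ℝ) ^ 3 / gap d L = (L : ℝ) ^ (d + 2) := by
    rw [gap_eq hL hd, div_div_eq_mul_div, pow_add,
      show (L : ℝ) ^ 3 * (L : ℝ) ^ d = (L : ℝ) ^ d * (L : ℝ) ^ 2 * L by ring, mul_div_cancel_right₀ _ hL0.ne']
  obtain ⟨hr1, hr2⟩ := radii_le_one hLd2 hB1 hC1 hM1 hT4 hT5
  have e8 : ∀ x : ℝ, 8 * x * (L : ℝ) ^ 3 / gap d L = 8 * x * (L : ℝ) ^ (d + 2) := fun x => by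
    rw [mul_div_assoc, hg]
  have e36 : ∀ x : ℝ, 36 * x * (L : ℝ) ^ 3 / gap d L = 36 * x * (L : ℝ) ^ (d + 2) := fun x => by
    rw [mul_div_assoc, hg]
  rw [e8, e36]
  have hmax1 := max_le (hbt.trans ht1) hr1
  have hmax2 := max_le (hct.trans ht1) hr2
  have hgc := gradConst_mono (d := d) (le_max_of_le_left hc) hmax2
  have hcube := pow_le_one₀ (n := 3) (le_max_of_le_left hb) hmax1
  have hW := wallConstNA_nonneg (d := d) L
  have hL2 : (0 : ℝ) < (L : ℝ) ^ 2 := by positivity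
  rw [div_le_div_iff_of_pos_right hL2]
  exact mul_le_mul_of_nonneg_left (add_le_add hgc hcube) hW

/-- **NE3, ROUTE (A) ON THE CELL's SMALL-FIELD CLASS** — the case `𝒞 = sfClass d L N ε` of `actionRate_thm1Type_class`:
(H∃) over `sfClass d L N ε` + `0 ≤ b, c ≤ t` + the five thresholds + `18(K_b + K_m)L^{d+2}·t ≤ ε` ⇒
`ActionRate (minActReadings d (sfClass d L N ε) L N dom loc) (wallConstNA(d,L)·(gradConst d 1 + 1)/L²) (L⁻²)`.
NE3 is NOT proved by this. [folklore] -/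
theorem actionRate_sfClass_thm1Type (hd : 1 ≤ d) {L N : ℕ} (hL : 1 ≤ L) (hN : 1 ≤ N) {b c t ε : ℝ}
    (hb : 0 ≤ b) (hc : 0 ≤ c) (hbt : b ≤ t) (hct : c ≤ t)
    (hT1 : (160 * d + 168 * (d : ℝ) ^ 2 + 2 * (32 * d + (24 * d * (2 * (d : ℝ) + gradRem d) + 14336 * (d : ℝ) ^ 2 * ((d : ℝ) + 1) ^ 2)
            + 12 * (2 * (d : ℝ) + gradRem d))
        + 512 * ((d : ℝ) + 1) * ((d : ℝ) + 4) * (L : ℝ) ^ 2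
          * (32 * d + 48 * d * (L : ℝ) ^ 2 * (2 * (d : ℝ) + gradRem d)
            + 8192 * (d : ℝ) ^ 2 * (2 * (d : ℝ) + 1) ^ 2 * (L : ℝ) ^ 2)) * t ≤ 1)
    (hT2 : 2 ^ 15 * ((d : ℝ) + 1) ^ 2 * ((d : ℝ) + 4) ^ 2 * (L : ℝ) ^ 2 * t ≤ 1)
    (hT3 : 2 ^ 14 * ((d : ℝ) + 1) * ((d : ℝ) + 4) * (L : ℝ) ^ (2 * d + 3)
          * ((32 * d + 48 * d * (L : ℝ) ^ 2 * (2 * (d : ℝ) + gradRem d)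
              + 8192 * (d : ℝ) ^ 2 * (2 * (d : ℝ) + 1) ^ 2 * (L : ℝ) ^ 2)
            + (3 * (1280 * d * ((d : ℝ) + 1) ^ 2 * ((d : ℝ) + 4) ^ 2 * (L : ℝ) ^ 2
            * (32 * d + 48 * d * (L : ℝ) ^ 2 * (2 * (d : ℝ) + gradRem d)
              + 8192 * (d : ℝ) ^ 2 * (2 * (d : ℝ) + 1) ^ 2 * (L : ℝ) ^ 2) ^ 2
          + d * ((d : ℝ) + 1) * ((L : ℝ) ^ 3 * (256 * (d : ℝ) ^ 2
              * (32 * d + (24 * d * (2 * (d : ℝ) + gradRem d) + 14336 * (d : ℝ) ^ 2 * ((d : ℝ) + 1) ^ 2)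
                + 12 * (2 * (d : ℝ) + gradRem d))
            + 4 * (24 * d * (2 * (d : ℝ) + gradRem d) + 14336 * (d : ℝ) ^ 2 * ((d : ℝ) + 1) ^ 2)
            + 24 * (2 * (d : ℝ) + gradRem d)))
          + ((d : ℝ) - 1) ^ 2 * (37 * ((d : ℝ) - 1) + 5)))) * t ≤ 1)
    (hT4 : ((32 * d + 48 * d * (L : ℝ) ^ 2 * (2 * (d : ℝ) + gradRem d)
              + 8192 * (d : ℝ) ^ 2 * (2 * (d : ℝ) + 1) ^ 2 * (L : ℝ) ^ 2)
            + 8 * (3 * (1280 * d * ((d : ℝ) + 1) ^ 2 * ((d : ℝ) + 4) ^ 2 * (L : ℝ) ^ 2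
            * (32 * d + 48 * d * (L : ℝ) ^ 2 * (2 * (d : ℝ) + gradRem d)
              + 8192 * (d : ℝ) ^ 2 * (2 * (d : ℝ) + 1) ^ 2 * (L : ℝ) ^ 2) ^ 2
          + d * ((d : ℝ) + 1) * ((L : ℝ) ^ 3 * (256 * (d : ℝ) ^ 2
              * (32 * d + (24 * d * (2 * (d : ℝ) + gradRem d) + 14336 * (d : ℝ) ^ 2 * ((d : ℝ) + 1) ^ 2)
                + 12 * (2 * (d : ℝ) + gradRem d))
            + 4 * (24 * d * (2 * (d : ℝ) + gradRem d) + 14336 * (d : ℝ) ^ 2 * ((d : ℝ) + 1) ^ 2)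
            + 24 * (2 * (d : ℝ) + gradRem d)))
          + ((d : ℝ) - 1) ^ 2 * (37 * ((d : ℝ) - 1) + 5))) * (L : ℝ) ^ (d + 2)) * t ≤ 1)
    (hT5 : (((L : ℝ) ^ 3 * (256 * (d : ℝ) ^ 2
              * (32 * d + (24 * d * (2 * (d : ℝ) + gradRem d) + 14336 * (d : ℝ) ^ 2 * ((d : ℝ) + 1) ^ 2)
                + 12 * (2 * (d : ℝ) + gradRem d))
            + 4 * (24 * d * (2 * (d : ℝ) + gradRem d) + 14336 * (d : ℝ) ^ 2 * ((d : ℝ) + 1) ^ 2)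
            + 24 * (2 * (d : ℝ) + gradRem d)))
            + 36 * (3 * (1280 * d * ((d : ℝ) + 1) ^ 2 * ((d : ℝ) + 4) ^ 2 * (L : ℝ) ^ 2
            * (32 * d + 48 * d * (L : ℝ) ^ 2 * (2 * (d : ℝ) + gradRem d)
              + 8192 * (d : ℝ) ^ 2 * (2 * (d : ℝ) + 1) ^ 2 * (L : ℝ) ^ 2) ^ 2
          + d * ((d : ℝ) + 1) * ((L : ℝ) ^ 3 * (256 * (d : ℝ) ^ 2
              * (32 * d + (24 * d * (2 * (d : ℝ) + gradRem d) + 14336 * (d : ℝ) ^ 2 * ((d : ℝ) + 1) ^ 2)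
                + 12 * (2 * (d : ℝ) + gradRem d))
            + 4 * (24 * d * (2 * (d : ℝ) + gradRem d) + 14336 * (d : ℝ) ^ 2 * ((d : ℝ) + 1) ^ 2)
            + 24 * (2 * (d : ℝ) + gradRem d)))
          + ((d : ℝ) - 1) ^ 2 * (37 * ((d : ℝ) - 1) + 5))) * (L : ℝ) ^ (d + 2)) * t ≤ 1)
    (hεt : 18 * ((32 * d + 48 * d * (L : ℝ) ^ 2 * (2 * (d : ℝ) + gradRem d)
              + 8192 * (d : ℝ) ^ 2 * (2 * (d : ℝ) + 1) ^ 2 * (L : ℝ) ^ 2)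
            + (3 * (1280 * d * ((d : ℝ) + 1) ^ 2 * ((d : ℝ) + 4) ^ 2 * (L : ℝ) ^ 2
            * (32 * d + 48 * d * (L : ℝ) ^ 2 * (2 * (d : ℝ) + gradRem d)
              + 8192 * (d : ℝ) ^ 2 * (2 * (d : ℝ) + 1) ^ 2 * (L : ℝ) ^ 2) ^ 2
          + d * ((d : ℝ) + 1) * ((L : ℝ) ^ 3 * (256 * (d : ℝ) ^ 2
              * (32 * d + (24 * d * (2 * (d : ℝ) + gradRem d) + 14336 * (d : ℝ) ^ 2 * ((d : ℝ) + 1) ^ 2)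
                + 12 * (2 * (d : ℝ) + gradRem d))
            + 4 * (24 * d * (2 * (d : ℝ) + gradRem d) + 14336 * (d : ℝ) ^ 2 * ((d : ℝ) + 1) ^ 2)
            + 24 * (2 * (d : ℝ) + gradRem d)))
          + ((d : ℝ) - 1) ^ 2 * (37 * ((d : ℝ) - 1) + 5)))) * (L : ℝ) ^ (d + 2) * t ≤ ε)
    {dom : Set (Site d → Fin d → (Matrix n n ℂ)ˣ)}
    (hmin : ∀ V ∈ dom, ∀ k : ℕ, ∃ U, IsMinimiser d (sfClass d L N ε) L N k V U ∧ RegularSup d L N b c k U)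
    {X : Type*} (loc : ℕ → (Site d → Fin d → (Matrix n n ℂ)ˣ) → X → ℝ) :
    ActionRate (minActReadings d (sfClass d L N ε) L N dom loc)
      (wallConstNA d L * (gradConst d 1 + 1) / (L : ℝ) ^ 2) (((L : ℝ) ^ 2)⁻¹) :=
  actionRate_thm1Type_class hd hL hN hb hc hbt hct (fun _ => subset_rfl) hT1 hT2 hT3 hT4 hT5 hεt hmin loc

/-- **THE LIMIT OF THE MINIMAL ACTIONS** (`L ≥ 2`): under the hypotheses of `actionRate_thm1Type_class`, for every datum
`V ∈ dom` the minimal actions `A_k(V) = minAct d 𝒞 L N k V` of the runs at lattice spacings `L^{−k}` CONVERGE as `k → ∞`, with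
the geometric tail `|A_k(V) − A(V)| ≤ [wallConstNA(d,L)(gradConst d 1 + 1)/L²]·N^d·(L⁻²)^k/(1 − L⁻²)`
(`T4EtaRateMin.ActionRate.exists_limit` BY NAME).  NE3 is NOT proved by this; (H∃) is a hypothesis. [folklore] -/
theorem exists_tendsto_minAct_thm1Type_class (hd : 1 ≤ d) {𝒞 : ℕ → Set (Site d → Fin d → (Matrix n n ℂ)ˣ)} {L N : ℕ}
    (hL : 2 ≤ L) (hN : 1 ≤ N) {b c t ε : ℝ} (hb : 0 ≤ b) (hc : 0 ≤ c) (hbt : b ≤ t) (hct : c ≤ t)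
    (hsub : ∀ j, sfClass d L N ε j ⊆ 𝒞 j)
    (hT1 : (160 * d + 168 * (d : ℝ) ^ 2 + 2 * (32 * d + (24 * d * (2 * (d : ℝ) + gradRem d) + 14336 * (d : ℝ) ^ 2 * ((d : ℝ) + 1) ^ 2)
            + 12 * (2 * (d : ℝ) + gradRem d))
        + 512 * ((d : ℝ) + 1) * ((d : ℝ) + 4) * (L : ℝ) ^ 2
          * (32 * d + 48 * d * (L : ℝ) ^ 2 * (2 * (d : ℝ) + gradRem d)
            + 8192 * (d : ℝ) ^ 2 * (2 * (d : ℝ) + 1) ^ 2 * (L : ℝ) ^ 2)) * t ≤ 1)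
    (hT2 : 2 ^ 15 * ((d : ℝ) + 1) ^ 2 * ((d : ℝ) + 4) ^ 2 * (L : ℝ) ^ 2 * t ≤ 1)
    (hT3 : 2 ^ 14 * ((d : ℝ) + 1) * ((d : ℝ) + 4) * (L : ℝ) ^ (2 * d + 3)
          * ((32 * d + 48 * d * (L : ℝ) ^ 2 * (2 * (d : ℝ) + gradRem d)
              + 8192 * (d : ℝ) ^ 2 * (2 * (d : ℝ) + 1) ^ 2 * (L : ℝ) ^ 2)
            + (3 * (1280 * d * ((d : ℝ) + 1) ^ 2 * ((d : ℝ) + 4) ^ 2 * (L : ℝ) ^ 2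
            * (32 * d + 48 * d * (L : ℝ) ^ 2 * (2 * (d : ℝ) + gradRem d)
              + 8192 * (d : ℝ) ^ 2 * (2 * (d : ℝ) + 1) ^ 2 * (L : ℝ) ^ 2) ^ 2
          + d * ((d : ℝ) + 1) * ((L : ℝ) ^ 3 * (256 * (d : ℝ) ^ 2
              * (32 * d + (24 * d * (2 * (d : ℝ) + gradRem d) + 14336 * (d : ℝ) ^ 2 * ((d : ℝ) + 1) ^ 2)
                + 12 * (2 * (d : ℝ) + gradRem d))
            + 4 * (24 * d * (2 * (d : ℝ) + gradRem d) + 14336 * (d : ℝ) ^ 2 * ((d : ℝ) + 1) ^ 2)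
            + 24 * (2 * (d : ℝ) + gradRem d)))
          + ((d : ℝ) - 1) ^ 2 * (37 * ((d : ℝ) - 1) + 5)))) * t ≤ 1)
    (hT4 : ((32 * d + 48 * d * (L : ℝ) ^ 2 * (2 * (d : ℝ) + gradRem d)
              + 8192 * (d : ℝ) ^ 2 * (2 * (d : ℝ) + 1) ^ 2 * (L : ℝ) ^ 2)
            + 8 * (3 * (1280 * d * ((d : ℝ) + 1) ^ 2 * ((d : ℝ) + 4) ^ 2 * (L : ℝ) ^ 2
            * (32 * d + 48 * d * (L : ℝ) ^ 2 * (2 * (d : ℝ) + gradRem d)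
              + 8192 * (d : ℝ) ^ 2 * (2 * (d : ℝ) + 1) ^ 2 * (L : ℝ) ^ 2) ^ 2
          + d * ((d : ℝ) + 1) * ((L : ℝ) ^ 3 * (256 * (d : ℝ) ^ 2
              * (32 * d + (24 * d * (2 * (d : ℝ) + gradRem d) + 14336 * (d : ℝ) ^ 2 * ((d : ℝ) + 1) ^ 2)
                + 12 * (2 * (d : ℝ) + gradRem d))
            + 4 * (24 * d * (2 * (d : ℝ) + gradRem d) + 14336 * (d : ℝ) ^ 2 * ((d : ℝ) + 1) ^ 2)
            + 24 * (2 * (d : ℝ) + gradRem d)))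
          + ((d : ℝ) - 1) ^ 2 * (37 * ((d : ℝ) - 1) + 5))) * (L : ℝ) ^ (d + 2)) * t ≤ 1)
    (hT5 : (((L : ℝ) ^ 3 * (256 * (d : ℝ) ^ 2
              * (32 * d + (24 * d * (2 * (d : ℝ) + gradRem d) + 14336 * (d : ℝ) ^ 2 * ((d : ℝ) + 1) ^ 2)
                + 12 * (2 * (d : ℝ) + gradRem d))
            + 4 * (24 * d * (2 * (d : ℝ) + gradRem d) + 14336 * (d : ℝ) ^ 2 * ((d : ℝ) + 1) ^ 2)
            + 24 * (2 * (d : ℝ) + gradRem d)))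
            + 36 * (3 * (1280 * d * ((d : ℝ) + 1) ^ 2 * ((d : ℝ) + 4) ^ 2 * (L : ℝ) ^ 2
            * (32 * d + 48 * d * (L : ℝ) ^ 2 * (2 * (d : ℝ) + gradRem d)
              + 8192 * (d : ℝ) ^ 2 * (2 * (d : ℝ) + 1) ^ 2 * (L : ℝ) ^ 2) ^ 2
          + d * ((d : ℝ) + 1) * ((L : ℝ) ^ 3 * (256 * (d : ℝ) ^ 2
              * (32 * d + (24 * d * (2 * (d : ℝ) + gradRem d) + 14336 * (d : ℝ) ^ 2 * ((d : ℝ) + 1) ^ 2)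
                + 12 * (2 * (d : ℝ) + gradRem d))
            + 4 * (24 * d * (2 * (d : ℝ) + gradRem d) + 14336 * (d : ℝ) ^ 2 * ((d : ℝ) + 1) ^ 2)
            + 24 * (2 * (d : ℝ) + gradRem d)))
          + ((d : ℝ) - 1) ^ 2 * (37 * ((d : ℝ) - 1) + 5))) * (L : ℝ) ^ (d + 2)) * t ≤ 1)
    (hεt : 18 * ((32 * d + 48 * d * (L : ℝ) ^ 2 * (2 * (d : ℝ) + gradRem d)
              + 8192 * (d : ℝ) ^ 2 * (2 * (d : ℝ) + 1) ^ 2 * (L : ℝ) ^ 2)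
            + (3 * (1280 * d * ((d : ℝ) + 1) ^ 2 * ((d : ℝ) + 4) ^ 2 * (L : ℝ) ^ 2
            * (32 * d + 48 * d * (L : ℝ) ^ 2 * (2 * (d : ℝ) + gradRem d)
              + 8192 * (d : ℝ) ^ 2 * (2 * (d : ℝ) + 1) ^ 2 * (L : ℝ) ^ 2) ^ 2
          + d * ((d : ℝ) + 1) * ((L : ℝ) ^ 3 * (256 * (d : ℝ) ^ 2
              * (32 * d + (24 * d * (2 * (d : ℝ) + gradRem d) + 14336 * (d : ℝ) ^ 2 * ((d : ℝ) + 1) ^ 2)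
                + 12 * (2 * (d : ℝ) + gradRem d))
            + 4 * (24 * d * (2 * (d : ℝ) + gradRem d) + 14336 * (d : ℝ) ^ 2 * ((d : ℝ) + 1) ^ 2)
            + 24 * (2 * (d : ℝ) + gradRem d)))
          + ((d : ℝ) - 1) ^ 2 * (37 * ((d : ℝ) - 1) + 5)))) * (L : ℝ) ^ (d + 2) * t ≤ ε)
    {dom : Set (Site d → Fin d → (Matrix n n ℂ)ˣ)}
    (hmin : ∀ V ∈ dom, ∀ k : ℕ, ∃ U, IsMinimiser d 𝒞 L N k V U ∧ RegularSup d L N b c k U)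
    {V : Site d → Fin d → (Matrix n n ℂ)ˣ} (hV : V ∈ dom) :
    ∃ A : ℝ, Tendsto (fun k => minAct d 𝒞 L N k V) atTop (𝓝 A) ∧
      ∀ k : ℕ, |minAct d 𝒞 L N k V - A|
        ≤ wallConstNA d L * (gradConst d 1 + 1) / (L : ℝ) ^ 2 * (N : ℝ) ^ d
            * (((L : ℝ) ^ 2)⁻¹) ^ k / (1 - ((L : ℝ) ^ 2)⁻¹) :=
  (actionRate_thm1Type_class hd (by omega) hN hb hc hbt hct hsub hT1 hT2 hT3 hT4 hT5 hεt hmin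
    (fun _ _ (_ : Unit) => (0 : ℝ))).exists_limit (rate_lt_one hL).2 hV

/-! ## §3 Non-vacuity: the flat datum -/

/-- **NON-VACUITY OF THE END's HYPOTHESIS SET**: at `b = c = t = 0` every threshold reads `0 ≤ 1`, the class-radius
condition reads `0 ≤ ε`, and (H∃) HOLDS for the flat datum (`dom = {flatCfg}`: the flat configuration is a minimiser of
every run over `sfClass d L N ε` — `MinimalActionWitness.isMinimiser_sfClass_flatCfg` — with sup-form regularity `(0, 0)` —
`MinimalActionRefine.regularSup_flatCfg`), so the END yields the (here trivial, but genuinely hypothesis-free) rate statement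
for flat data.  The END's hypotheses are therefore jointly satisfiable; nothing is smuggled. [folklore] -/
theorem actionRate_thm1Type_flat (hd : 1 ≤ d) {L N : ℕ} (hL : 1 ≤ L) (hN : 1 ≤ N) {ε : ℝ} (hε : 0 ≤ ε)
    {X : Type*} (loc : ℕ → (Site d → Fin d → (Matrix n n ℂ)ˣ) → X → ℝ) :
    ActionRate (minActReadings d (sfClass d L N ε) L N {(flatCfg : Site d → Fin d → (Matrix n n ℂ)ˣ)} loc)
      (wallConstNA d L * (gradConst d 1 + 1) / (L : ℝ) ^ 2) (((L : ℝ) ^ 2)⁻¹) := by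
  refine actionRate_sfClass_thm1Type hd hL hN (b := 0) (c := 0) (t := 0) le_rfl le_rfl le_rfl le_rfl
    (by rw [mul_zero]; exact zero_le_one) (by rw [mul_zero]; exact zero_le_one) (by rw [mul_zero]; exact zero_le_one)
    (by rw [mul_zero]; exact zero_le_one) (by rw [mul_zero]; exact zero_le_one) (by rw [mul_zero]; exact hε) ?_ loc
  intro V hV k
  rw [Set.mem_singleton_iff] at hV
  subst hV
  exact ⟨flatCfg, isMinimiser_sfClass_flatCfg hL N hε k, regularSup_flatCfg L N k le_rfl le_rfl⟩

end

end Summit.QuantumFields.BalabanUV.T4Continuum.MinimalActionThm1Type
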